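import Summits.QuantumFields.BalabanUV.Beta.GAN24.PairingCellTransfer
import Summits.QuantumFields.BalabanUV.Beta.GAN24.JointPeriodicCellSwap
import Summits.QuantumFields.BalabanUV.Beta.GAN24.EEWordValue
import Summits.QuantumFields.BalabanUV.Beta.GAN24.FaceWordCurrentsDeep

/-!
# `BalabanUV.Beta.GAN24.FaceWordCellPairingDeep` — binder row G-an2-4 ∕ (CONV-C), W-slot (α-0), ROW (C)sym AT LEVELS `≥ 1`, typer's PART VI row **T6-VAL**, the
# (γ) hand's letter **K7-a** (memo `HOME/b2b-balaban-gan24-formalise-leaf-06/g55/HX-VALUES-g55.md` §7, steps (1)–(2)–(4)): **THE DIRECT EXCHANGE FACE WORD OF A FINE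
# ff-TABLE AT PERIOD `N` — leaf-02 g69's Part 45 `FaceWordsDeepCurrents.faceWord_direct_eq` OUTPUT — IS THE CELL PAIRING OF ITS TWO PERIOD-`N` TWO-FACE CURRENTS THROUGH THE
# MIDDLE KERNEL**: `Σ_{rr∈box N} Σ'_t χ_N(rr_μ)χ_N(t_ν)·Σ'_{(y,w)} χ_N(y_α)χ_N(w_β)·((S μ rr ∘ X) ∘ S ν t)(y,w)(inl α)(inl β)
#  = Σ_{x∈box N} Σ_a FF_L(a,x)·Σ'_z Σ_b X(x,z)_{ab}·FF_R(b,z)`, `FF_L(a,x) = Σ'_y χ_N(y_α)·Σ'_t [t_μ face]·S μ t (y,x)_{αa}`, `FF_R(b,z) = Σ'_w χ_N(w_β)·Σ'_t [t_ν face]·S ν t (z,w)_{bβ}`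
# — the INPUT form of this seat's `FaceWordEEValueDeep.cellPairing_deep_value(_units)` (generic `d`; ANY local stencil family `S` with field legs only, `N`-covariant; ANY decaying
# `N`-invariant kernel `X`; common rate `δ > 0`; every `N ≥ 1`)
# (G-an2-4 CRUX TEAM (2), seat `b2b-balaban-gan24-formalise-leaf-06` = the (γ) hand, gen 56; journal [GAN24LEAF06-G56-INTENT2])

NOT IN PRINT; OUR BOOKKEEPING ([folklore] dominated Fubini BY NAME over leaf-02's Part 42 `PairingCellTransfer.nested_eq_facePairing ∕ ite_eq_mask_mul` (the right current exposed),
leaf-04's `EEWordValue.fubini3` (the pairing site exposed) and `RespGaugeStencil.decays_faceStencil ∕ tsum_faceface_block_periodic` (the face-gated slot sum decays; block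
periodicity), leaf-06 K4a `JointPeriodicCellSwap.sum_box_tsum_swap_weight` (cell bond ↔ pairing site), an2's `ExpKernelCalculus`; 0 `def`, 0 cited fact, 0 `def … : Prop`, 0 sorry).
HONEST FRAMING (cell contract, verbatim): «discharging `BetaPertH` makes Bałaban's UV stability UNCONDITIONAL — a real constructive-QFT result; it is NOT the continuum
limit and NOT the Clay problem.»  HONEST DEPENDENCY (verbatim): «continuum YM on T⁴ ⇐ BetaPertH ∧ nine spine estimates (0/9 proved); BetaPertH ⇐ (D1) ∧ (D4) ∧ CAP+tail;
G-an2-4 gates asym, D1 and NE2/3/4.»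

WHAT ([folklore]; `χ_N(n) = [n % N = N − 1]`; hypotheses `hS : LocStencil S Cs δ`, `hX : Decays X CX δ`, `hδ : 0 < δ`, `hSt : S κ (t + N•s) = shiftK (−N•s) (S κ t)`,
`hXt : shiftK (−N•s) X = X`, and for §4 the field-legs-only hypotheses `hSl ∕ hSr` (no multiplier leg in `S` — an2's `e3OfK` tables)):
* (the currents' kinematics — bounds, periodicity, covariance, the Fubini into `FF_L` — are this seat's `FaceWordCurrentsDeep`);
* §3 the per-bond reduction `word_bond_eq` (Part 42 ⨾ `fubini3`): the word with the right bond lattice-summed `= Σ'_x Σ_f L_v(f,x)·(X FF_R)(f,x)`; the applied kernel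
  `X FF_R` is bounded (`abs_applyR_le`, `summable_applyR`) and `N`-periodic (`applyR_periodic`);
* §4 **`faceWord_eq_cellPairing`** — the display above (K4a moves the cell from the bond to the pairing site; the fibre sums collapse to field legs).
Asserts NO value of any table; discharges NOTHING of `hX` ∕ `hXu` ∕ (C)_{≥1} ∕ `hB0` ∕ `hBF` ∕ (Q-L) ∕ (hW, hWall); NEVER «G-an2-4 closed» as (CONV-C); NOT D1, NOT `BetaPertH`,
NOT continuum, NOT Clay.  2026-08-24; no existing file touched.
-/

noncomputable section

open Finset
open scoped BigOperators
open Literature.MathematicalPhysics.QuantumFieldTheory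
open Literature.MathematicalPhysics.QuantumFieldTheory.Balaban1983to89
open Literature.MathematicalPhysics.QuantumFieldTheory.Balaban1983to89.Beta
open B12Sec2to5 (l1 l1_nonneg)
open ExpKernelCalculus (Site MKer Decays BiLoc shiftK comp Zl Zl_pos Zl_nonneg summable_exp_shift summable_exp_shift' tsum_exp_shift tsum_exp_shift' l1_sub_symm)
open OneStepResolventKernel (Fib LocStencil)
open AffineAveraging (box toSite)
open Summit.QuantumFields.BalabanUV.Beta.GAN24.PairingCellTransfer (nested_eq_facePairing ite_eq_mask_mul)
open Summit.QuantumFields.BalabanUV.Beta.GAN24.JointPeriodicCellSwap (sum_box_tsum_swap_weight)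
open Summit.QuantumFields.BalabanUV.Beta.GAN24.EEWordValue (fubini3)
open Summit.QuantumFields.BalabanUV.Beta.GAN24.FaceWordCurrentsDeep (faceR_mask_eq abs_faceR_le faceR_periodic abs_leftCurrent_le leftCurrent_cov tsum_leftCurrent_eq_faceL)

namespace Summit.QuantumFields.BalabanUV.Beta.GAN24.FaceWordCellPairingDeep

variable {d : ℕ} {N : ℕ} [NeZero N]
variable {S : Fin (d + 1) → Site (d + 1) → MKer (d + 1) (Fib d)} {X : MKer (d + 1) (Fib d)} {Cs CX δ : ℝ}

/-! ## §3 The per-bond reduction: right bond lattice-summed, pairing site exposed -/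

omit [NeZero N] in
/-- [folklore] The applied kernel `(X FF_R)(f,x) = Σ'_z Σ_g X(x,z)_{fg}·FF_R(g,z)` (Part 42's spelling of `FF_R`): each `z`-term is bounded by `card(Fib)·CX·M·e^{−δ|x−z|₁}`. -/
theorem abs_applyR_term_le (hX : Decays X CX δ) {R : Fib d → Site (d + 1) → ℝ} {M : ℝ} (hR : ∀ g z, |R g z| ≤ M) (x z : Site (d + 1)) (f : Fib d) :
    |∑ g : Fib d, X x z f g * R g z| ≤ (Fintype.card (Fib d) : ℝ) * (CX * M) * Real.exp (-δ * l1 (x - z)) := by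
  have hM : 0 ≤ M := (abs_nonneg _).trans (hR (Sum.inl 0) 0)
  calc |∑ g : Fib d, X x z f g * R g z| ≤ ∑ g : Fib d, |X x z f g * R g z| := Finset.abs_sum_le_sum_abs _ _
    _ ≤ ∑ _g : Fib d, (CX * M) * Real.exp (-δ * l1 (x - z)) := Finset.sum_le_sum fun g _ => by
        rw [abs_mul]
        calc |X x z f g| * |R g z| ≤ (CX * Real.exp (-δ * l1 (x - z))) * M := mul_le_mul (hX x z f g) (hR g z) (abs_nonneg _) (by
              have := hX.nonneg (Sum.inl 0); positivity)
          _ = (CX * M) * Real.exp (-δ * l1 (x - z)) := by ring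
    _ = (Fintype.card (Fib d) : ℝ) * (CX * M) * Real.exp (-δ * l1 (x - z)) := by
        rw [Finset.sum_const, Finset.card_univ, nsmul_eq_mul]; ring

omit [NeZero N] in
/-- [folklore] Summability of `z ↦ Σ_g X(x,z)_{fg}·R(g,z)` for bounded `R`. -/
theorem summable_applyR (hX : Decays X CX δ) (hδ : 0 < δ) {R : Fib d → Site (d + 1) → ℝ} {M : ℝ} (hR : ∀ g z, |R g z| ≤ M) (x : Site (d + 1)) (f : Fib d) :
    Summable fun z : Site (d + 1) => ∑ g : Fib d, X x z f g * R g z :=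
  Summable.of_norm_bounded ((summable_exp_shift hδ x).mul_left ((Fintype.card (Fib d) : ℝ) * (CX * M))) fun z => by
    rw [Real.norm_eq_abs]; exact abs_applyR_term_le hX hR x z f

omit [NeZero N] in
/-- [folklore] **THE APPLIED KERNEL IS BOUNDED**: `|Σ'_z Σ_g X(x,z)_{fg}·R(g,z)| ≤ card(Fib)·CX·M·Zl(δ)`. -/
theorem abs_applyR_le (hX : Decays X CX δ) (hδ : 0 < δ) {R : Fib d → Site (d + 1) → ℝ} {M : ℝ} (hR : ∀ g z, |R g z| ≤ M) (x : Site (d + 1)) (f : Fib d) :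
    |∑' z : Site (d + 1), ∑ g : Fib d, X x z f g * R g z| ≤ (Fintype.card (Fib d) : ℝ) * (CX * M) * Zl (d + 1) δ := by
  have hmaj := ((summable_exp_shift hδ x).mul_left ((Fintype.card (Fib d) : ℝ) * (CX * M))).hasSum
  have hb := tsum_of_norm_bounded hmaj (f := fun z : Site (d + 1) => ∑ g : Fib d, X x z f g * R g z) fun z => by
    rw [Real.norm_eq_abs]; exact abs_applyR_term_le hX hR x z f
  rw [Real.norm_eq_abs] at hb
  refine hb.trans (le_of_eq ?_)
  rw [tsum_mul_left, tsum_exp_shift]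

omit [NeZero N] in
/-- [folklore] **THE APPLIED KERNEL IS `N`-PERIODIC** for an `N`-invariant kernel and an `N`-periodic datum. -/
theorem applyR_periodic (hXt : ∀ s : Site (d + 1), shiftK (-((N : ℤ) • s)) X = X) {R : Fib d → Site (d + 1) → ℝ}
    (hRp : ∀ g z s, R g (z + (N : ℤ) • s) = R g z) (x s : Site (d + 1)) (f : Fib d) :
    (∑' z : Site (d + 1), ∑ g : Fib d, X (x + (N : ℤ) • s) z f g * R g z) = ∑' z : Site (d + 1), ∑ g : Fib d, X x z f g * R g z := by
  rw [← (Equiv.addRight ((N : ℤ) • s)).tsum_eq]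
  refine tsum_congr fun z => Finset.sum_congr rfl fun g _ => ?_
  simp only [Equiv.coe_addRight]
  have hx : X (x + (N : ℤ) • s) (z + (N : ℤ) • s) f g = X x z f g := by
    have h := congrArg (fun K : MKer (d + 1) (Fib d) => K (x + (N : ℤ) • s) (z + (N : ℤ) • s) f g) (hXt s)
    simpa only [shiftK, add_neg_cancel_right] using h.symm
  rw [hx, hRp]

omit [NeZero N] in
/-- [folklore] **THE PER-BOND REDUCTION** (Part 42's `nested_eq_facePairing` ⨾ leaf-04's `fubini3`): the exchange face word of the bond `v` with the RIGHT bond lattice-summed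
against the period-`N` face weight and both legs face-weighted equals the lattice pairing of the left single-bond current with the applied right current,
`Σ'_t χ_N(t_ν)·Σ'_{(y,w)} χ_N(y_α)χ_N(w_β)·((S μ v ∘ X) ∘ S ν t)(y,w)(inl α)(inl β) = Σ'_x Σ_f L_v(f,x)·Σ'_z Σ_g X(x,z)_{fg}·FF_R(g,z)` (Part 42's spelling of `FF_R`). -/
theorem word_bond_eq (hS : LocStencil S Cs δ) (hX : Decays X CX δ) (hδ : 0 < δ) (μ ν α β : Fin (d + 1)) (v : Site (d + 1)) :
    (∑' t : Site (d + 1), (if t ν % (N : ℤ) = (N : ℤ) - 1 then (1 : ℝ) else 0) *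
        ∑' yw : Site (d + 1) × Site (d + 1), (if yw.1 α % (N : ℤ) = (N : ℤ) - 1 then (1 : ℝ) else 0) * (if yw.2 β % (N : ℤ) = (N : ℤ) - 1 then (1 : ℝ) else 0) *
          comp (comp (S μ v) X) (S ν t) yw.1 yw.2 (Sum.inl α) (Sum.inl β)) =
      ∑' x : Site (d + 1), ∑ f : Fib d, (∑' y : Site (d + 1), (if y α % (N : ℤ) = (N : ℤ) - 1 then (1 : ℝ) else 0) * S μ v y x (Sum.inl α) f) *
        ∑' z : Site (d + 1), ∑ g : Fib d, X x z f g *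
          (∑' w : Site (d + 1), (if w β % (N : ℤ) = (N : ℤ) - 1 then (1 : ℝ) else 0) *
            ((1 : ℝ) * ∑' t : Site (d + 1), (if t ν % (N : ℤ) = (N : ℤ) - 1 then (1 : ℝ) else 0) * S ν t z w g (Sum.inl β))) := by
  have hCs : 0 ≤ Cs := (hS 0 0).nonneg (Sum.inl 0)
  have hCX : 0 ≤ CX := hX.nonneg (Sum.inl 0)
  rw [← one_mul (∑' t : Site (d + 1), (if t ν % (N : ℤ) = (N : ℤ) - 1 then (1 : ℝ) else 0) *
        ∑' yw : Site (d + 1) × Site (d + 1), (if yw.1 α % (N : ℤ) = (N : ℤ) - 1 then (1 : ℝ) else 0) * (if yw.2 β % (N : ℤ) = (N : ℤ) - 1 then (1 : ℝ) else 0) *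
          comp (comp (S μ v) X) (S ν t) yw.1 yw.2 (Sum.inl α) (Sum.inl β)),
    ← nested_eq_facePairing hS hX hδ (N : ℤ) μ ν α β v 1]
  -- bound on the right current in Part 42's spelling
  have hRb : ∀ (g : Fib d) (z : Site (d + 1)), |∑' w : Site (d + 1), (if w β % (N : ℤ) = (N : ℤ) - 1 then (1 : ℝ) else 0) *
      ((1 : ℝ) * ∑' t : Site (d + 1), (if t ν % (N : ℤ) = (N : ℤ) - 1 then (1 : ℝ) else 0) * S ν t z w g (Sum.inl β))| ≤
      Cs * Zl (d + 1) (δ / 2) * Zl (d + 1) (δ / 2) := by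
    intro g z
    rw [faceR_mask_eq (N := N) ν β z g (Sum.inl β)]
    exact abs_faceR_le (N := N) hS hδ ν β z g (Sum.inl β)
  have hM : 0 ≤ Cs * Zl (d + 1) (δ / 2) * Zl (d + 1) (δ / 2) := by
    have := (Zl_pos (D := d + 1) (half_pos hδ)).le; positivity
  have key := fubini3 (ι := Fib d) (f := fun y : Site (d + 1) => (if y α % (N : ℤ) = (N : ℤ) - 1 then (1 : ℝ) else 0))
    (V := fun y y₁ a => S μ v y y₁ (Sum.inl α) a) (X := fun y₁ z a b => X y₁ z a b)
    (T := fun g z => ∑' w : Site (d + 1), (if w β % (N : ℤ) = (N : ℤ) - 1 then (1 : ℝ) else 0) *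
      ((1 : ℝ) * ∑' t : Site (d + 1), (if t ν % (N : ℤ) = (N : ℤ) - 1 then (1 : ℝ) else 0) * S ν t z w g (Sum.inl β)))
    (c := v) hδ hCs hCX hM (fun y => by split_ifs <;> simp) (fun y y₁ a => hS μ v y y₁ (Sum.inl α) a) (fun y₁ z a b => hX y₁ z a b) hRb
  simp only [comp] at key ⊢
  exact key

/-! ## §4 The face word as the cell pairing of the two two-face currents -/

/-- NOT IN PRINT; OUR BOOKKEEPING.  **THE DIRECT EXCHANGE FACE WORD OF A FIELD-LEG TABLE AT PERIOD `N` IS THE CELL PAIRING OF ITS TWO PERIOD-`N` TWO-FACE CURRENTS THROUGH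
THE MIDDLE KERNEL** (module docstring): for a local stencil family `S` with field legs only (`hSl`, `hSr`), `N`-covariant (`hSt`), and a decaying `N`-invariant kernel `X`,
`Σ_{rr∈box N} Σ'_t χ_N(rr_μ)χ_N(t_ν)·Σ'_{(y,w)} χ_N(y_α)χ_N(w_β)·((S μ rr ∘ X) ∘ S ν t)(y,w)(inl α)(inl β) = Σ_{x∈box N} Σ_a FF_L(a,x)·Σ'_z Σ_b X(x,z)_{ab}·FF_R(b,z)`. -/
theorem faceWord_eq_cellPairing (hS : LocStencil S Cs δ) (hX : Decays X CX δ) (hδ : 0 < δ)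
    (hSt : ∀ (κ : Fin (d + 1)) (t s : Site (d + 1)), S κ (t + (N : ℤ) • s) = shiftK (-((N : ℤ) • s)) (S κ t))
    (hXt : ∀ s : Site (d + 1), shiftK (-((N : ℤ) • s)) X = X)
    (hSl : ∀ (κ : Fin (d + 1)) (t y x : Site (d + 1)) (m : Fin (d + 1)) (b : Fib d), S κ t y x (Sum.inr m) b = 0)
    (hSr : ∀ (κ : Fin (d + 1)) (t y x : Site (d + 1)) (a : Fib d) (m : Fin (d + 1)), S κ t y x a (Sum.inr m) = 0)
    (μ ν α β : Fin (d + 1)) :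
    ∑ rr ∈ box (d + 1) N, ∑' t : Site (d + 1), (if toSite rr μ % (N : ℤ) = (N : ℤ) - 1 then (1 : ℝ) else 0) * (if t ν % (N : ℤ) = (N : ℤ) - 1 then (1 : ℝ) else 0) *
        ∑' yw : Site (d + 1) × Site (d + 1), (if yw.1 α % (N : ℤ) = (N : ℤ) - 1 then (1 : ℝ) else 0) * (if yw.2 β % (N : ℤ) = (N : ℤ) - 1 then (1 : ℝ) else 0) *
          comp (comp (S μ (toSite rr)) X) (S ν t) yw.1 yw.2 (Sum.inl α) (Sum.inl β) =
      ∑ x ∈ box (d + 1) N, ∑ a : Fin (d + 1),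
        (∑' y : Site (d + 1), (if y α % (N : ℤ) = (N : ℤ) - 1 then (1 : ℝ) else 0) *
          ∑' t : Site (d + 1), (if t μ % (N : ℤ) = (N : ℤ) - 1 then S μ t y (toSite x) (Sum.inl α) (Sum.inl a) else 0)) *
        (∑' z : Site (d + 1), ∑ b : Fin (d + 1), X (toSite x) z (Sum.inl a) (Sum.inl b) *
          (∑' w : Site (d + 1), (if w β % (N : ℤ) = (N : ℤ) - 1 then (1 : ℝ) else 0) *
            ∑' t : Site (d + 1), (if t ν % (N : ℤ) = (N : ℤ) - 1 then S ν t z w (Sum.inl b) (Sum.inl β) else 0))) := by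
  classical
  have hCs : 0 ≤ Cs := (hS 0 0).nonneg (Sum.inl 0)
  have hCX : 0 ≤ CX := hX.nonneg (Sum.inl 0)
  -- Part 42's spelling of the right current `R`, its bound and periodicity
  set R : Fib d → Site (d + 1) → ℝ := fun g z => ∑' w : Site (d + 1), (if w β % (N : ℤ) = (N : ℤ) - 1 then (1 : ℝ) else 0) *
    ((1 : ℝ) * ∑' t : Site (d + 1), (if t ν % (N : ℤ) = (N : ℤ) - 1 then (1 : ℝ) else 0) * S ν t z w g (Sum.inl β)) with hRdef
  have hReq : ∀ g z, R g z = ∑' w : Site (d + 1), (if w β % (N : ℤ) = (N : ℤ) - 1 then (1 : ℝ) else 0) *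
      ∑' t : Site (d + 1), (if t ν % (N : ℤ) = (N : ℤ) - 1 then S ν t z w g (Sum.inl β) else 0) := fun g z => faceR_mask_eq (N := N) ν β z g (Sum.inl β)
  have hRb : ∀ g z, |R g z| ≤ Cs * Zl (d + 1) (δ / 2) * Zl (d + 1) (δ / 2) := fun g z => by
    rw [hReq]; exact abs_faceR_le (N := N) hS hδ ν β z g (Sum.inl β)
  have hRp : ∀ g z s, R g (z + (N : ℤ) • s) = R g z := fun g z s => by
    rw [hReq, hReq]; exact faceR_periodic (N := N) hSt ν β z s g (Sum.inl β)
  have hRinr : ∀ (m : Fin (d + 1)) z, R (Sum.inr m) z = 0 := fun m z => by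
    rw [hReq]
    simp only [hSl, ite_self, tsum_zero, mul_zero]
  -- the left single-bond current `L v f x` and the two-slot family `G`
  set L : Site (d + 1) → Fib d → Site (d + 1) → ℝ := fun v f x =>
    ∑' y : Site (d + 1), (if y α % (N : ℤ) = (N : ℤ) - 1 then (1 : ℝ) else 0) * S μ v y x (Sum.inl α) f with hLdef
  set A : Fib d → Site (d + 1) → ℝ := fun f x => ∑' z : Site (d + 1), ∑ g : Fib d, X x z f g * R g z with hAdef
  set G : Site (d + 1) → Site (d + 1) → ℝ := fun v x => ∑ f : Fib d, L v f x * A f x with hGdef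
  have hAb : ∀ f x, |A f x| ≤ (Fintype.card (Fib d) : ℝ) * (CX * (Cs * Zl (d + 1) (δ / 2) * Zl (d + 1) (δ / 2))) * Zl (d + 1) δ :=
    fun f x => abs_applyR_le hX hδ hRb x f
  have hAp : ∀ f x s, A f (x + (N : ℤ) • s) = A f x := fun f x s => applyR_periodic (N := N) hXt hRp x s f
  have hLb : ∀ v f x, |L v f x| ≤ Cs * Zl (d + 1) δ * Real.exp (-δ * l1 (x - v)) := fun v f x => abs_leftCurrent_le (N := N) hS hδ μ α v x f
  have hLc : ∀ v f x s, L (v + (N : ℤ) • s) f (x + (N : ℤ) • s) = L v f x := fun v f x s => leftCurrent_cov (N := N) hSt μ α v x s f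
  -- Step 1: per bond, the word is `Σ'_x G rr x`
  have step1 : ∀ rr : Fin (d + 1) → ℕ,
      (∑' t : Site (d + 1), (if toSite rr μ % (N : ℤ) = (N : ℤ) - 1 then (1 : ℝ) else 0) * (if t ν % (N : ℤ) = (N : ℤ) - 1 then (1 : ℝ) else 0) *
        ∑' yw : Site (d + 1) × Site (d + 1), (if yw.1 α % (N : ℤ) = (N : ℤ) - 1 then (1 : ℝ) else 0) * (if yw.2 β % (N : ℤ) = (N : ℤ) - 1 then (1 : ℝ) else 0) *
          comp (comp (S μ (toSite rr)) X) (S ν t) yw.1 yw.2 (Sum.inl α) (Sum.inl β)) =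
      (if toSite rr μ % (N : ℤ) = (N : ℤ) - 1 then (1 : ℝ) else 0) * ∑' x : Site (d + 1), (1 : ℝ) * G (toSite rr) x := by
    intro rr
    have e : (fun t : Site (d + 1) => (if toSite rr μ % (N : ℤ) = (N : ℤ) - 1 then (1 : ℝ) else 0) * (if t ν % (N : ℤ) = (N : ℤ) - 1 then (1 : ℝ) else 0) *
        ∑' yw : Site (d + 1) × Site (d + 1), (if yw.1 α % (N : ℤ) = (N : ℤ) - 1 then (1 : ℝ) else 0) * (if yw.2 β % (N : ℤ) = (N : ℤ) - 1 then (1 : ℝ) else 0) *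
          comp (comp (S μ (toSite rr)) X) (S ν t) yw.1 yw.2 (Sum.inl α) (Sum.inl β)) =
        fun t : Site (d + 1) => (if toSite rr μ % (N : ℤ) = (N : ℤ) - 1 then (1 : ℝ) else 0) * ((if t ν % (N : ℤ) = (N : ℤ) - 1 then (1 : ℝ) else 0) *
        ∑' yw : Site (d + 1) × Site (d + 1), (if yw.1 α % (N : ℤ) = (N : ℤ) - 1 then (1 : ℝ) else 0) * (if yw.2 β % (N : ℤ) = (N : ℤ) - 1 then (1 : ℝ) else 0) *
          comp (comp (S μ (toSite rr)) X) (S ν t) yw.1 yw.2 (Sum.inl α) (Sum.inl β)) := by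
      funext t; ring
    rw [e, tsum_mul_left, word_bond_eq (N := N) hS hX hδ μ ν α β (toSite rr)]
    congr 1
    refine tsum_congr fun x => ?_
    simp only [hGdef, hLdef, hAdef, hRdef, one_mul]
  rw [Finset.sum_congr rfl fun rr _ => step1 rr]
  -- Step 2: K4a moves the cell from the bond `rr` to the pairing site `x`
  have hGcov : ∀ (v x s : Site (d + 1)), G (v + (N : ℤ) • s) (x + (N : ℤ) • s) = G v x := by
    intro v x s
    simp only [hGdef, hLc, hAp]
  have hGb : ∀ v x, |G v x| ≤ (Fintype.card (Fib d) : ℝ) * ((Cs * Zl (d + 1) δ) *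
      ((Fintype.card (Fib d) : ℝ) * (CX * (Cs * Zl (d + 1) (δ / 2) * Zl (d + 1) (δ / 2))) * Zl (d + 1) δ)) * Real.exp (-δ * l1 (x - v)) := by
    intro v x
    calc |G v x| ≤ ∑ f : Fib d, |L v f x * A f x| := Finset.abs_sum_le_sum_abs _ _
      _ ≤ ∑ _f : Fib d, ((Cs * Zl (d + 1) δ) * ((Fintype.card (Fib d) : ℝ) * (CX * (Cs * Zl (d + 1) (δ / 2) * Zl (d + 1) (δ / 2))) * Zl (d + 1) δ)) *
            Real.exp (-δ * l1 (x - v)) := Finset.sum_le_sum fun f _ => by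
          rw [abs_mul]
          have h0 : 0 ≤ (Fintype.card (Fib d) : ℝ) * (CX * (Cs * Zl (d + 1) (δ / 2) * Zl (d + 1) (δ / 2))) * Zl (d + 1) δ := by
            have := (Zl_pos (D := d + 1) (half_pos hδ)).le; have := (Zl_pos (D := d + 1) hδ).le; positivity
          calc |L v f x| * |A f x| ≤ (Cs * Zl (d + 1) δ * Real.exp (-δ * l1 (x - v))) *
                ((Fintype.card (Fib d) : ℝ) * (CX * (Cs * Zl (d + 1) (δ / 2) * Zl (d + 1) (δ / 2))) * Zl (d + 1) δ) :=
                mul_le_mul (hLb v f x) (hAb f x) (abs_nonneg _) (by have := (Zl_pos (D := d + 1) hδ).le; positivity)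
            _ = _ := by ring
      _ = _ := by rw [Finset.sum_const, Finset.card_univ, nsmul_eq_mul]; ring
  have hGa : ∀ v : Site (d + 1), Summable fun x : Site (d + 1) => (fun _ : Site (d + 1) => (1 : ℝ)) x * G v x := by
    intro v
    refine Summable.of_norm_bounded ((summable_exp_shift' hδ v).mul_left ((Fintype.card (Fib d) : ℝ) * ((Cs * Zl (d + 1) δ) *
      ((Fintype.card (Fib d) : ℝ) * (CX * (Cs * Zl (d + 1) (δ / 2) * Zl (d + 1) (δ / 2))) * Zl (d + 1) δ)))) fun x => ?_
    simp only [Real.norm_eq_abs, one_mul]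
    exact hGb v x
  have hGbs : ∀ x : Site (d + 1), Summable fun v : Site (d + 1) => (if v μ % (N : ℤ) = (N : ℤ) - 1 then (1 : ℝ) else 0) * G v x := by
    intro x
    refine Summable.of_norm_bounded ((summable_exp_shift hδ x).mul_left ((Fintype.card (Fib d) : ℝ) * ((Cs * Zl (d + 1) δ) *
      ((Fintype.card (Fib d) : ℝ) * (CX * (Cs * Zl (d + 1) (δ / 2) * Zl (d + 1) (δ / 2))) * Zl (d + 1) δ)))) fun v => ?_
    rw [Real.norm_eq_abs, abs_mul]
    have h1 : |(if v μ % (N : ℤ) = (N : ℤ) - 1 then (1 : ℝ) else 0)| ≤ 1 := by split_ifs <;> simp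
    calc |(if v μ % (N : ℤ) = (N : ℤ) - 1 then (1 : ℝ) else 0)| * |G v x| ≤ 1 * _ := mul_le_mul h1 (hGb v x) (abs_nonneg _) zero_le_one
      _ = _ := one_mul _
  rw [sum_box_tsum_swap_weight (P := N) (Q := N) G (fun v : Site (d + 1) => (if v μ % (N : ℤ) = (N : ℤ) - 1 then (1 : ℝ) else 0))
      (fun _ : Site (d + 1) => (1 : ℝ)) hGcov
      (fun v s => by simp only [Pi.add_apply, Pi.smul_apply, smul_eq_mul, Int.add_mul_emod_self_left]) (fun _ _ => rfl) hGa hGbs]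
  refine Finset.sum_congr rfl fun x _ => ?_
  simp only [one_mul]
  -- Step 3: at the pairing site, the fibre sum comes out of the bond series and the bond series is the left two-face current
  have hLs : ∀ f : Fib d, Summable fun v : Site (d + 1) => (if v μ % (N : ℤ) = (N : ℤ) - 1 then (1 : ℝ) else 0) * (L v f (toSite x) * A f (toSite x)) := by
    intro f
    refine Summable.of_norm_bounded ((summable_exp_shift hδ (toSite x)).mul_left ((Cs * Zl (d + 1) δ) *
      ((Fintype.card (Fib d) : ℝ) * (CX * (Cs * Zl (d + 1) (δ / 2) * Zl (d + 1) (δ / 2))) * Zl (d + 1) δ))) fun v => ?_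
    rw [Real.norm_eq_abs, abs_mul, abs_mul]
    have h1 : |(if v μ % (N : ℤ) = (N : ℤ) - 1 then (1 : ℝ) else 0)| ≤ 1 := by split_ifs <;> simp
    have h0 : 0 ≤ (Fintype.card (Fib d) : ℝ) * (CX * (Cs * Zl (d + 1) (δ / 2) * Zl (d + 1) (δ / 2))) * Zl (d + 1) δ := by
      have := (Zl_pos (D := d + 1) (half_pos hδ)).le; have := (Zl_pos (D := d + 1) hδ).le; positivity
    calc |(if v μ % (N : ℤ) = (N : ℤ) - 1 then (1 : ℝ) else 0)| * (|L v f (toSite x)| * |A f (toSite x)|)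
        ≤ 1 * ((Cs * Zl (d + 1) δ * Real.exp (-δ * l1 (toSite x - v))) *
            ((Fintype.card (Fib d) : ℝ) * (CX * (Cs * Zl (d + 1) (δ / 2) * Zl (d + 1) (δ / 2))) * Zl (d + 1) δ)) :=
          mul_le_mul h1 (mul_le_mul (hLb v f (toSite x)) (hAb f (toSite x)) (abs_nonneg _) (by have := (Zl_pos (D := d + 1) hδ).le; positivity))
            (by positivity) zero_le_one
      _ = _ := by ring
  have step3 : (∑' v : Site (d + 1), (if v μ % (N : ℤ) = (N : ℤ) - 1 then (1 : ℝ) else 0) * G v (toSite x)) =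
      ∑ f : Fib d, (∑' v : Site (d + 1), (if v μ % (N : ℤ) = (N : ℤ) - 1 then (1 : ℝ) else 0) * L v f (toSite x)) * A f (toSite x) := by
    have e1 : ∀ v : Site (d + 1), (if v μ % (N : ℤ) = (N : ℤ) - 1 then (1 : ℝ) else 0) * G v (toSite x) =
        ∑ f : Fib d, (if v μ % (N : ℤ) = (N : ℤ) - 1 then (1 : ℝ) else 0) * (L v f (toSite x) * A f (toSite x)) := fun v => by
      simp only [hGdef, Finset.mul_sum]
    rw [tsum_congr e1, Summable.tsum_finsetSum (fun f _ => hLs f)]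
    refine Finset.sum_congr rfl fun f _ => ?_
    rw [← tsum_mul_right]
    exact tsum_congr fun v => by ring
  rw [step3]
  -- Step 4: the fibre sums collapse to field legs
  rw [Fintype.sum_sum_type]
  have hLinr : ∀ (m : Fin (d + 1)) (v : Site (d + 1)), L v (Sum.inr m) (toSite x) = 0 := fun m v => by
    simp only [hLdef, hSr, mul_zero, tsum_zero]
  simp only [hLinr, mul_zero, tsum_zero, zero_mul, Finset.sum_const_zero, add_zero]
  refine Finset.sum_congr rfl fun a _ => ?_
  -- the left factor: Fubini into the left two-face current
  rw [show (∑' v : Site (d + 1), (if v μ % (N : ℤ) = (N : ℤ) - 1 then (1 : ℝ) else 0) * L v (Sum.inl a) (toSite x)) =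
      ∑' y : Site (d + 1), (if y α % (N : ℤ) = (N : ℤ) - 1 then (1 : ℝ) else 0) *
        ∑' t : Site (d + 1), (if t μ % (N : ℤ) = (N : ℤ) - 1 then S μ t y (toSite x) (Sum.inl α) (Sum.inl a) else 0) from
    tsum_leftCurrent_eq_faceL (N := N) hS hδ μ α (toSite x) (Sum.inl a)]
  congr 1
  -- the right factor: fibre sum to field legs, Part 42's spelling to the `if`-spelling
  simp only [hAdef]
  refine tsum_congr fun z => ?_
  rw [Fintype.sum_sum_type]
  simp only [hRinr, mul_zero, Finset.sum_const_zero, add_zero]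
  exact Finset.sum_congr rfl fun b _ => by rw [hReq]

end Summit.QuantumFields.BalabanUV.Beta.GAN24.FaceWordCellPairingDeep

end
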